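import Literature.MathematicalPhysics.QuantumFieldTheory.Balaban1983to89.B14DomainGeom

/-!
# `Balaban1983to89.B14Components` — the two printed CONNECTIVITY notions for unions of cubes («components» of a
large field region vs. the «connected family» of a localization domain), typed side by side on the cube lattice of
`…B14DomainGeom`, with the kernel facts that separate them (cell `GAPS.md` C-adv5-15 (i), G-adv5-10;
`DIVERGENCE.md` D-adv5.8, D-pv02.16)

CITATION HEADER (lean-in-tree rule 2026-08-18).  Sources: T. Bałaban, *Convergent renormalization expansions for
lattice gauge theories*, Commun. Math. Phys. **119**, 243–285 (1988) [Balaban1988Convergent] (cell paper B14 =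
[III]) p. 258; *Renormalization group approach to lattice gauge field theories. I*, CMP **109**, 249–301 (1987)
[Balaban1987RG1] (= [I], B12) pp. 251, 257; *Large field renormalization. I*, CMP **122**, 175–202 (1989)
[Balaban1989LargeFieldI] (= [IV], B15) p. 177; *Large field renormalization. II*, CMP **122**, 355–392 (1989)
[Balaban1989LargeFieldII] (B16) pp. 386, 391.  All quotations below were read by the typist on the x2 page renders
of the cell folder `b2b-balaban-ref1/pages/` (`1988-cmp119-…-p016`, `1987-cmp109-…-p003`, `…-p009`,
`1989-cmp122-large-field-I-p003`, `1989-cmp122-large-field-II-p032`, `…-p037`).  The papers are manuscripts UNDER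
ADJUDICATION by the audit cell `pub-balaban`: NOTHING printed in them is asserted here.  Every `theorem` below is
elementary (integer/real box arithmetic, reflexive–transitive closures), proved without `sorry` and without new
axioms.  NEW sibling module of unit `b2b-balaban-pv02` (gen 3, journal claim C-adv5-15-i-CONNECTIVITY-KERNEL),
answering the referee note `b2b-balaban-adv5-g6` → pv02 (2026-08-18): *"Typing suggestion (not done, not owner):
B14DomainGeom gets BOTH predicates — Touching (components of regions) and WallAdjacent (D_j)"*.  It imports
`…B14DomainGeom` (pv02; `Pt`, `cubeIdx`, `IdxNear`, `enl`, `Within`, `IsUnionOfCubes`) and modifies nothing.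

THE PRINTED TEXT (verbatim).
* [III] p. 258 [PDF 16]: *"The last large field region is Z_k, and 𝐓_k is supported in it, in the sense that it
  involves integrations and variables restricted to this region. If Z_k is represented as a union of disjoint
  regions, e.g. as a union of connected components, Z_k = X₁∪....∪X_n, X_i∩X_j = ∅ for i ≠ j, then
  𝐓_k(Z_k) = Π_{i=1}^{n} 𝐓_k(X_i). (2.19) The operations corresponding to disjoint regions commute"*; and, after
  (2.21): *"More precisely, the quadratic form in the exponential couples only the fields A_j in the same component
  of Z_{j+1}∩Ω_{j+1}. The other terms of this quadratic form are included into the effective action into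
  𝐁-terms."*
* [I] p. 251 [PDF 3]: *"Consider a lattice as a subset of a continuous Euclidean space R^d, or a torus T … These
  spaces are divided into regular lattices of cubes with corners at points of L^{−n}Z^d, n = 0, 1, … . Each lattice
  determines a lattice of centers of these cubes"*; *"It is convenient to determine subsets of a lattice by subsets
  of continuous space. We consider only subsets which are unions of cubes of a division described above. Such a
  subset determines a set of lattice points, of a given scale, belonging to it, a set of bonds, i.e. intervals b
  connecting nearest neighbor points b₋, b₊, which intersect it, and a set of plaquettes, i.e. elementary squares
  of the lattice, which intersect it. We denote all these sets by the same symbol denoting the continuous space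
  set."*
* [I] p. 257 [PDF 9]: *"We decompose the space T into the lattice of closed cubes of a size M … We introduce a
  notion of a localization domain. Such a domain is a union of a connected, finite family of cubes from π_j. A
  connected family means that for every pair □, □′ of cubes from the family there exists a sequence □, □₁, …, □_n,
  □′ of cubes belonging to the family and such that two consecutive cubes have a common wall, i.e. their
  intersection is a d−1-dimensional cube. We denote localization domains by X, X′, Y, etc. … The class of all
  these localization domains is denoted by 𝐃_j."*
* [IV] p. 177 [PDF 3]: *"Each term in the expansion (2.18) [III] has a large field region Λ^c_k. It is a union of
  connected components."*; *"Thus we write the factorization property (2.19) [III],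
  𝕋_k(Z_k) = 𝕋_k(Z_k∩Z^c)𝕋_k(Z) = 𝕋_k(Z_k∩Z^c) Π_{i=1}^{m} 𝕋_k(X_i), (1.1) where Z = ∪_{i=1}^{m} X_i is the
  decomposition into disjoint components."*
* B16 p. 386 [PDF 32]: *"Define the graph G in the following way: the set of vertices of G is
  {Z_j^{(n)}, Z_{j+1}^{(i)}}, and a pair of domains is a line in G if the union of corresponding domains in (1.84)
  is a connected domain, i.e., if the corresponding domains intersect, or touch each other."*
* B16 p. 391 [PDF 37]: *"Also, we use the ordinary notion of connectedness to define components."*  [Context,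
  cross-read C-pv23-9 R1, render p037 re-read by the typist: this sentence is printed inside B16's *"final remark
  about another possible representation of the kᵗʰ density"* (p. 391, leading to (1.103)–(1.104)), among the
  modifications of the polymer expansion (1.90)–(1.92) for that representation — i.e. for the components entering
  THOSE activities, not as a blanket convention for large field regions; it is used below only as wording support
  for `TConn` (closed-set connectedness of the carrier, `touching_iff_realCube_meet`).]

THE MODEL (dictionary, cell DIVERGENCE.md D-pv02.16).  As in `…B14DomainGeom`: lattice sites are `Pt d = ℤ^d`
(integer coordinates; [I]'s sites are the cube CENTRES `εℤ^d + ½ε`, i.e. our site `x` is the continuum point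
`x + ½`), the cubes of a division of side `s` (in site units) are indexed by `c ∈ ℤ^d`, the site `x` lying in the
cube `cubeIdx s x` (`{y | s·cᵢ ≤ yᵢ < s·cᵢ + s}` — no site lies on a face); the CLOSED CONTINUUM cube of index `c` is
`realCube s c = Π_i [s·cᵢ, s·cᵢ + s] ⊂ ℝ^d` ([I] p. 251 *"unions of cubes of a division"*, p. 257 *"closed cubes"*).
Two relations on cube indices:
* `Touching c c'` — `|cᵢ − c′ᵢ| ≤ 1` for all `i`; KERNEL: ⟺ the closed continuum cubes intersect
  (`touching_iff_realCube_meet`) — B16 p. 386 *"intersect, or touch each other"*, p. 391 *"the ordinary notion of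
  connectedness"*; on sites it is `IdxNear s 1` of `…B14DomainGeom` (`idxNear_one_iff`).
* `WallAdjacent c c'` — exactly one coordinate differs, by `1`; KERNEL: ⟹ `Touching`, and the closed cubes then
  intersect exactly in the common face `{x | x_i = s·max(cᵢ, c′ᵢ), x_j ∈ [s·c_j, s·c_j + s] (j ≠ i)}`
  (`realCube_inter_of_wallAdjacent`) — [I] p. 257 *"have a common wall, i.e. their intersection is a
  d−1-dimensional cube"* (the class 𝐃_j).
Chains inside a set `R` of cube indices (`TConn R`, `WConn R` = reflexive–transitive closures of the two step
relations restricted to `R`) give the two notions of COMPONENT (`tComp`, `wComp`).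

WHAT IS KERNEL-CHECKED.  (A) `WallAdjacent → Touching`; every wall-chain is a touching-chain, so each
touching-component is a union of wall-components (`wconn_imp_tconn`, `wComp_subset_tComp`).  (B) The two notions
DIFFER from `d ≥ 2` on: the corner pair `0`, `𝟙 = (1,…,1)` is `Touching` and not `WallAdjacent`; in
`R = {0, 𝟙}` the two cubes form ONE touching-component but TWO wall-components WHOSE CLOSED CUBES MEET
(`corner_pair_not_wconn`, `corner_pair_closed_cubes_meet`) — the kernel form of cell GAPS.md G-adv5-10 /
C-adv5-15 (b): read with wall-components, (2.19)'s *"e.g. as a union of connected components, … X_i∩X_j = ∅"* would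
exclude the very example it names.  (C) SEPARATION under the touching reading: cubes in distinct touching-components
of `R` never touch (`not_touching_of_not_tconn`), hence their closed continuum carriers are DISJOINT
(`disjoint_realCarrier_of_not_tconn`) — (2.19)/(1.1) consistent exactly as printed; at site level, with
`…B14DomainGeom`: the touching-components (`pComp s X a`) of a union of side-`s` cubes `X` are unions of cubes
(`pComp_isUnionOfCubes`), distinct ones lie outside each other's one-cube enlargement `enl s 1`
(`pComp_subset_compl_enl`) and their sites are at sup-distance `> s` (`not_within_of_not_pconn`) — the
"separated by at least one cube width" used in C-adv5-15's consequence for (2.21).  (D) Bonds never cross a corner: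
the cubes of the endpoints `x`, `x + e_μ` of a lattice bond are equal or wall-adjacent (`bond_cubes`) — so cubes
that touch without a common wall share no bond ([I] p. 251's bond convention; cf. cell GAPS C-B13-02a).

WHAT IS *NOT* ASSERTED: which notion the papers mean where they say «component» — the series never states it for
regions; the cell's READING (C-adv5-15: the ordinary = touching notion for components of regions, wall-connectivity
only for the localization domains 𝐃_j) rests on the quotations above and is recorded, not adjudicated, in
DIVERGENCE.md D-adv5.8 / D-pv02.16; nothing about 𝐓_k, (2.21) or the expansions is typed here.  Finite-ness of
families, the torus identification and the scale index `j` are suppressed (one lattice `ℤ^d`, one side `s`).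
Value = typed conventions + kernel dichotomy for a located ambiguity, NOT summit progress.  Companion rows: cell
`GAPS.md` C-B14s-11; `DIVERGENCE.md` D-pv02.16.
-/

namespace Literature.MathematicalPhysics.QuantumFieldTheory.Balaban1983to89.B14Components

open Literature.MathematicalPhysics.QuantumFieldTheory.Balaban1983to89.B14DomainGeom

variable {d : ℕ}

/-! ## A. Two adjacency relations on cube indices -/

/-- `Touching c c'`: the cube indices differ by at most `1` in every coordinate — the closed continuum cubes
*"intersect, or touch each other"* (B16 p. 386; kernel: `touching_iff_realCube_meet`).
[cite: Balaban1989LargeFieldII, p.386] -/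
def Touching (c c' : Pt d) : Prop := ∀ i, |c i - c' i| ≤ 1

/-- `WallAdjacent c c'`: exactly one coordinate of the indices differs, and by `1` — *"two consecutive cubes have a
common wall, i.e. their intersection is a d−1-dimensional cube"* ([I] p. 257, the connectivity of the localization
domains 𝐃_j; kernel: `realCube_inter_of_wallAdjacent`). [cite: Balaban1987RG1, p.257] -/
def WallAdjacent (c c' : Pt d) : Prop := ∃ i, |c i - c' i| = 1 ∧ ∀ j, j ≠ i → c j = c' j

/-- [folklore] -/
theorem Touching.refl (c : Pt d) : Touching c c := fun i => by simp

/-- [folklore] -/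
theorem Touching.symm {c c' : Pt d} (h : Touching c c') : Touching c' c :=
  fun i => by rw [abs_sub_comm]; exact h i

/-- [folklore] -/
theorem WallAdjacent.symm {c c' : Pt d} (h : WallAdjacent c c') : WallAdjacent c' c := by
  obtain ⟨i, hi, hrest⟩ := h
  exact ⟨i, by rw [abs_sub_comm]; exact hi, fun j hj => (hrest j hj).symm⟩

/-- A common wall is in particular a common point: `WallAdjacent → Touching`. [folklore] -/
theorem WallAdjacent.touching {c c' : Pt d} (h : WallAdjacent c c') : Touching c c' := by
  obtain ⟨i, hi, hrest⟩ := h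
  intro j
  by_cases hj : j = i
  · subst hj; exact le_of_eq hi
  · rw [hrest j hj]; simp

/-- Wall-adjacent cubes are distinct. [folklore] -/
theorem WallAdjacent.ne {c c' : Pt d} (h : WallAdjacent c c') : c ≠ c' := by
  rintro rfl
  obtain ⟨i, hi, _⟩ := h
  simp at hi

/-- [folklore] -/
theorem not_wallAdjacent_self (c : Pt d) : ¬ WallAdjacent c c := fun h => h.ne rfl

/-- The all-ones index `𝟙 = (1, …, 1)`: the cube diagonally across a corner from the cube `0`. [folklore] -/
def ones : Pt d := fun _ => 1

/-- The corner pair touches … [folklore] -/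
theorem touching_zero_ones : Touching (0 : Pt d) ones := fun i => by simp [ones]

/-- … but has no common wall as soon as `d ≥ 2` (two coordinates differ).  This is the pair behind cell GAPS.md
G-adv5-10's corner-sharing cubes. [folklore] -/
theorem not_wallAdjacent_zero_ones (hd : 2 ≤ d) : ¬ WallAdjacent (0 : Pt d) ones := by
  rintro ⟨i, _, hrest⟩
  haveI : Nontrivial (Fin d) := Fin.nontrivial_iff_two_le.mpr hd
  obtain ⟨j, hj⟩ := exists_ne i
  have h := hrest j hj
  simp [ones] at h

/-! ## B. The continuum dictionary: closed cubes of a division ([I] pp. 251, 257) -/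

/-- The CLOSED continuum cube of index `c` and side `s`: `Π_i [s·cᵢ, s·cᵢ + s] ⊂ ℝ^d` (*"regular lattices of cubes
with corners at points of L^{−n}Z^d"*, *"the lattice of closed cubes of a size M"*). [cite: Balaban1987RG1, p.251, p.257] -/
def realCube (s : ℕ) (c : Pt d) : Set (Fin d → ℝ) :=
  {x | ∀ i, (s : ℝ) * (c i : ℝ) ≤ x i ∧ x i ≤ (s : ℝ) * (c i : ℝ) + s}

/-- **Touching = the closed cubes intersect** (`s > 0`): B16 p. 386's *"intersect, or touch each other"* for two
cubes of one division is exactly `Touching` of their indices. [cite: Balaban1989LargeFieldII, p.386] -/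
theorem touching_iff_realCube_meet {s : ℕ} (hs : 0 < s) (c c' : Pt d) :
    Touching c c' ↔ (realCube s c ∩ realCube s c').Nonempty := by
  have hsR : (0 : ℝ) < s := by exact_mod_cast hs
  constructor
  · intro h
    refine ⟨fun i => (s : ℝ) * max (c i : ℝ) (c' i : ℝ), ?_, ?_⟩
    · intro i
      have h1 := abs_le.mp (h i)
      have h2 : (c' i : ℝ) ≤ (c i : ℝ) + 1 := by exact_mod_cast (by linarith [h1.1] : c' i ≤ c i + 1)
      refine ⟨mul_le_mul_of_nonneg_left (le_max_left _ _) hsR.le, ?_⟩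
      have : max (c i : ℝ) (c' i : ℝ) ≤ (c i : ℝ) + 1 := max_le (by linarith) h2
      nlinarith
    · intro i
      have h1 := abs_le.mp (h i)
      have h2 : (c i : ℝ) ≤ (c' i : ℝ) + 1 := by exact_mod_cast (by linarith [h1.2] : c i ≤ c' i + 1)
      refine ⟨mul_le_mul_of_nonneg_left (le_max_right _ _) hsR.le, ?_⟩
      have : max (c i : ℝ) (c' i : ℝ) ≤ (c' i : ℝ) + 1 := max_le h2 (by linarith)
      nlinarith
  · rintro ⟨x, hx, hx'⟩ i
    obtain ⟨a1, a2⟩ := hx i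
    obtain ⟨b1, b2⟩ := hx' i
    have k1 : (s : ℝ) * ((c' i : ℝ) - (c i : ℝ) - 1) ≤ 0 := by nlinarith
    have k2 : (s : ℝ) * ((c i : ℝ) - (c' i : ℝ) - 1) ≤ 0 := by nlinarith
    have l1 : (c' i : ℝ) - (c i : ℝ) - 1 ≤ 0 := by
      by_contra hcon
      push Not at hcon
      have := mul_pos hsR hcon
      linarith
    have l2 : (c i : ℝ) - (c' i : ℝ) - 1 ≤ 0 := by
      by_contra hcon
      push Not at hcon
      have := mul_pos hsR hcon
      linarith
    have m1 : c' i - c i - 1 ≤ 0 := by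
      have : ((c' i - c i - 1 : ℤ) : ℝ) ≤ 0 := by push_cast; linarith
      exact_mod_cast this
    have m2 : c i - c' i - 1 ≤ 0 := by
      have : ((c i - c' i - 1 : ℤ) : ℝ) ≤ 0 := by push_cast; linarith
      exact_mod_cast this
    rw [abs_le]
    constructor <;> linarith

/-- **Wall adjacency ⟹ the closed cubes meet exactly in the common face** `{x | x_i = s·max(cᵢ, c′ᵢ),
x_j ∈ [s·c_j, s·c_j + s] for j ≠ i}` (a `d−1`-dimensional cube of side `s` for `s > 0`): [I] p. 257's *"i.e. their
intersection is a d−1-dimensional cube"*, forward direction. [cite: Balaban1987RG1, p.257] -/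
theorem realCube_inter_of_wallAdjacent {s : ℕ} {c c' : Pt d} {i : Fin d} (hi : |c i - c' i| = 1)
    (hrest : ∀ j, j ≠ i → c j = c' j) :
    realCube s c ∩ realCube s c' =
      {x | x i = (s : ℝ) * max (c i : ℝ) (c' i : ℝ) ∧
        ∀ j, j ≠ i → (s : ℝ) * (c j : ℝ) ≤ x j ∧ x j ≤ (s : ℝ) * (c j : ℝ) + s} := by
  have hsR : (0 : ℝ) ≤ s := by exact_mod_cast Nat.zero_le s
  -- the two cases `c' i = c i + 1` and `c i = c' i + 1`
  have hcase : c' i = c i + 1 ∨ c i = c' i + 1 := by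
    rcases (abs_eq (by norm_num : (0 : ℤ) ≤ 1)).mp hi with h | h
    · right; linarith
    · left; linarith
  ext x
  simp only [realCube, Set.mem_inter_iff, Set.mem_setOf_eq]
  constructor
  · rintro ⟨hx, hx'⟩
    refine ⟨?_, fun j _ => hx j⟩
    obtain ⟨a1, a2⟩ := hx i
    obtain ⟨b1, b2⟩ := hx' i
    rcases hcase with h | h
    · have hc : (c' i : ℝ) = (c i : ℝ) + 1 := by exact_mod_cast h
      rw [hc, max_eq_right (by linarith)]
      rw [hc] at b1
      linarith
    · have hc : (c i : ℝ) = (c' i : ℝ) + 1 := by exact_mod_cast h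
      rw [hc, max_eq_left (by linarith)]
      rw [hc] at a1
      linarith
  · rintro ⟨hxi, hxr⟩
    constructor
    · intro j
      by_cases hj : j = i
      · subst hj
        rw [hxi]
        constructor
        · exact mul_le_mul_of_nonneg_left (le_max_left _ _) hsR
        · rcases hcase with h | h
          · have hc : (c' j : ℝ) = (c j : ℝ) + 1 := by exact_mod_cast h
            rw [hc, max_eq_right (by linarith)]; linarith
          · have hc : (c j : ℝ) = (c' j : ℝ) + 1 := by exact_mod_cast h
            rw [hc, max_eq_left (by linarith)]; linarith
      · exact hxr j hj
    · intro j
      by_cases hj : j = i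
      · subst hj
        rw [hxi]
        constructor
        · exact mul_le_mul_of_nonneg_left (le_max_right _ _) hsR
        · rcases hcase with h | h
          · have hc : (c' j : ℝ) = (c j : ℝ) + 1 := by exact_mod_cast h
            rw [hc, max_eq_right (by linarith)]; linarith
          · have hc : (c j : ℝ) = (c' j : ℝ) + 1 := by exact_mod_cast h
            rw [hc, max_eq_left (by linarith)]; linarith
      · rw [← hrest j hj]; exact hxr j hj

/-! ## C. Components: chains of touching / wall-adjacent cubes inside a set of cube indices -/

/-- One touching step inside `R`. [folklore] -/
def TStep (R : Set (Pt d)) (a b : Pt d) : Prop := a ∈ R ∧ b ∈ R ∧ Touching a b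

/-- One common-wall step inside `R` ([I] p. 257: *"two consecutive cubes have a common wall"*). [cite: Balaban1987RG1, p.257] -/
def WStep (R : Set (Pt d)) (a b : Pt d) : Prop := a ∈ R ∧ b ∈ R ∧ WallAdjacent a b

/-- `TConn R a b`: a chain of cubes of `R`, consecutive ones touching — the *"ordinary notion of connectedness"*
(B16 p. 391, printed there for the components in the polymer expansion of the alternative representation (1.104);
see the header's context note) for the closed set `∪_{c∈R} realCube s c` (cf. `touching_iff_realCube_meet`).
[cite: Balaban1989LargeFieldII, p.391] -/
def TConn (R : Set (Pt d)) : Pt d → Pt d → Prop := Relation.ReflTransGen (TStep R)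

/-- `WConn R a b`: *"there exists a sequence □, □₁, …, □_n, □′ of cubes belonging to the family and such that two
consecutive cubes have a common wall"* ([I] p. 257, the class 𝐃_j). [cite: Balaban1987RG1, p.257] -/
def WConn (R : Set (Pt d)) : Pt d → Pt d → Prop := Relation.ReflTransGen (WStep R)

/-- The touching-component of `a` in `R`. [cite: Balaban1988Convergent, (2.19) p.258] -/
def tComp (R : Set (Pt d)) (a : Pt d) : Set (Pt d) := {b | TConn R a b}

/-- The wall-component of `a` in `R`. [cite: Balaban1987RG1, p.257] -/
def wComp (R : Set (Pt d)) (a : Pt d) : Set (Pt d) := {b | WConn R a b}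

/-- Every wall-chain is a touching-chain. [folklore] -/
theorem wconn_imp_tconn {R : Set (Pt d)} {a b : Pt d} (h : WConn R a b) : TConn R a b := by
  induction h with
  | refl => exact Relation.ReflTransGen.refl
  | tail _ hstep ih => exact Relation.ReflTransGen.tail ih ⟨hstep.1, hstep.2.1, hstep.2.2.touching⟩

/-- Hence wall-components refine touching-components: each touching-component is a union of wall-components.
[folklore] -/
theorem wComp_subset_tComp (R : Set (Pt d)) (a : Pt d) : wComp R a ⊆ tComp R a :=
  fun _ hb => wconn_imp_tconn hb

/-- [folklore] -/
theorem TConn.symm {R : Set (Pt d)} {a b : Pt d} (h : TConn R a b) : TConn R b a := by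
  induction h with
  | refl => exact Relation.ReflTransGen.refl
  | tail _ hstep ih => exact Relation.ReflTransGen.head ⟨hstep.2.1, hstep.1, hstep.2.2.symm⟩ ih

/-- [folklore] -/
theorem WConn.symm {R : Set (Pt d)} {a b : Pt d} (h : WConn R a b) : WConn R b a := by
  induction h with
  | refl => exact Relation.ReflTransGen.refl
  | tail _ hstep ih => exact Relation.ReflTransGen.head ⟨hstep.2.1, hstep.1, hstep.2.2.symm⟩ ih

/-- A chain starting in `R` ends in `R`. [folklore] -/
theorem TConn.mem_right {R : Set (Pt d)} {a b : Pt d} (ha : a ∈ R) (h : TConn R a b) : b ∈ R := by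
  induction h with
  | refl => exact ha
  | tail _ hstep _ => exact hstep.2.1

/-- [folklore] -/
theorem mem_tComp_self (R : Set (Pt d)) (a : Pt d) : a ∈ tComp R a := Relation.ReflTransGen.refl

/-- [folklore] -/
theorem tComp_subset {R : Set (Pt d)} {a : Pt d} (ha : a ∈ R) : tComp R a ⊆ R :=
  fun _ hb => TConn.mem_right ha hb

/-- **Separation (touching reading).**  Cubes lying in two DISTINCT touching-components of `R` never touch.
[cite: Balaban1988Convergent, (2.19) p.258] -/
theorem not_touching_of_not_tconn {R : Set (Pt d)} {a b : Pt d} (ha : a ∈ R) (hb : b ∈ R)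
    (hab : ¬ TConn R a b) {x y : Pt d} (hx : x ∈ tComp R a) (hy : y ∈ tComp R b) : ¬ Touching x y := by
  intro hxy
  apply hab
  have hxR : x ∈ R := TConn.mem_right ha hx
  have hyR : y ∈ R := TConn.mem_right hb hy
  exact (Relation.ReflTransGen.tail hx ⟨hxR, hyR, hxy⟩).trans (TConn.symm hy)

/-- The closed continuum carrier `∪_{c ∈ C} realCube s c` of a set of cube indices ([I] p. 251: *"subsets of a
lattice by subsets of continuous space … unions of cubes of a division"*). [cite: Balaban1987RG1, p.251] -/
def realCarrier (s : ℕ) (C : Set (Pt d)) : Set (Fin d → ℝ) := ⋃ c ∈ C, realCube s c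

/-- **(2.19) under the touching reading:** distinct touching-components have DISJOINT closed continuum carriers —
*"X_i∩X_j = ∅ for i ≠ j"* holds for *"a union of connected components"* exactly as printed (`s > 0`).
[cite: Balaban1988Convergent, (2.19) p.258; Balaban1989LargeFieldI, (1.1) p.177] -/
theorem disjoint_realCarrier_of_not_tconn {s : ℕ} (hs : 0 < s) {R : Set (Pt d)} {a b : Pt d} (ha : a ∈ R)
    (hb : b ∈ R) (hab : ¬ TConn R a b) :
    Disjoint (realCarrier s (tComp R a)) (realCarrier s (tComp R b)) := by
  rw [Set.disjoint_left]
  intro x hx hx'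
  simp only [realCarrier, Set.mem_iUnion] at hx hx'
  obtain ⟨c, hc, hxc⟩ := hx
  obtain ⟨c', hc', hxc'⟩ := hx'
  exact not_touching_of_not_tconn ha hb hab hc hc' ((touching_iff_realCube_meet hs c c').mpr ⟨x, hxc, hxc'⟩)

/-- **The wall reading fails (2.19)'s example** (`d ≥ 2`): in `R = {0, 𝟙}` the cube `𝟙` is NOT in the
wall-component of `0` … [folklore] -/
theorem corner_pair_not_wconn (hd : 2 ≤ d) : ¬ WConn ({0, ones} : Set (Pt d)) 0 ones := by
  have key : ∀ b : Pt d, WConn ({0, ones} : Set (Pt d)) 0 b → b = 0 := by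
    intro b h
    induction h with
    | refl => rfl
    | @tail b' c' _ hstep ih =>
        obtain ⟨_, hc, hw⟩ := hstep
        subst ih
        simp only [Set.mem_insert_iff, Set.mem_singleton_iff] at hc
        rcases hc with rfl | rfl
        · rfl
        · exact absurd hw (not_wallAdjacent_zero_ones hd)
  intro h
  have h1 := key _ h
  have h2 := congrFun h1 ⟨0, by omega⟩
  simp [ones] at h2

/-- … although the two cubes form ONE touching-component … [folklore] -/
theorem corner_pair_tconn : TConn ({0, ones} : Set (Pt d)) 0 ones :=
  Relation.ReflTransGen.single ⟨by simp, by simp, touching_zero_ones⟩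

/-- … and their closed continuum cubes MEET (at the corner `s·𝟙`): two distinct wall-components that are NOT
disjoint as closed sets — cell GAPS.md C-adv5-15 (b). [folklore] -/
theorem corner_pair_closed_cubes_meet {s : ℕ} (hs : 0 < s) :
    (realCube s (0 : Pt d) ∩ realCube s ones).Nonempty :=
  (touching_iff_realCube_meet hs 0 ones).mp touching_zero_ones

/-! ## D. Site level, with `…B14DomainGeom`: touching-components of a union of cubes and their separation -/

/-- Dictionary: `IdxNear s 1 x y` of `…B14DomainGeom` (the side-`s` cubes of the sites `x`, `y` *"equal or
touching, corners included"*) is `Touching` of their cube indices. [folklore] -/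
theorem idxNear_one_iff (s : ℕ) (x y : Pt d) : IdxNear s 1 x y ↔ Touching (cubeIdx s x) (cubeIdx s y) := by
  simp only [IdxNear, Touching, Nat.cast_one]

/-- One touching step between sites of `X`. [folklore] -/
def PStep (s : ℕ) (X : Set (Pt d)) (x y : Pt d) : Prop := x ∈ X ∧ y ∈ X ∧ IdxNear s 1 x y

/-- Touching-connectivity of sites of `X` through the side-`s` cubes. [cite: Balaban1989LargeFieldII, p.391] -/
def PConn (s : ℕ) (X : Set (Pt d)) : Pt d → Pt d → Prop := Relation.ReflTransGen (PStep s X)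

/-- The touching-component of the site `a` in `X` (a *"component"* of a large field region in the reading of cell
GAPS.md C-adv5-15). [cite: Balaban1988Convergent, (2.19) p.258] -/
def pComp (s : ℕ) (X : Set (Pt d)) (a : Pt d) : Set (Pt d) := {y | PConn s X a y}

/-- [folklore] -/
theorem PConn.symm {s : ℕ} {X : Set (Pt d)} {a b : Pt d} (h : PConn s X a b) : PConn s X b a := by
  induction h with
  | refl => exact Relation.ReflTransGen.refl
  | tail _ hstep ih => exact Relation.ReflTransGen.head ⟨hstep.2.1, hstep.1, hstep.2.2.symm⟩ ih

/-- [folklore] -/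
theorem PConn.mem_right {s : ℕ} {X : Set (Pt d)} {a b : Pt d} (ha : a ∈ X) (h : PConn s X a b) : b ∈ X := by
  induction h with
  | refl => exact ha
  | tail _ hstep _ => exact hstep.2.1

/-- [folklore] -/
theorem mem_pComp_self (s : ℕ) (X : Set (Pt d)) (a : Pt d) : a ∈ pComp s X a := Relation.ReflTransGen.refl

/-- [folklore] -/
theorem pComp_subset {s : ℕ} {X : Set (Pt d)} {a : Pt d} (ha : a ∈ X) : pComp s X a ⊆ X :=
  fun _ hy => PConn.mem_right ha hy

/-- A component of a union of side-`s` cubes is a union of side-`s` cubes. [folklore] -/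
theorem pComp_isUnionOfCubes {s : ℕ} {X : Set (Pt d)} {a : Pt d} (ha : a ∈ X) (hX : IsUnionOfCubes s X) :
    IsUnionOfCubes s (pComp s X a) := by
  intro x y hxy
  constructor
  · intro hx
    have hxX : x ∈ X := PConn.mem_right ha hx
    have hyX : y ∈ X := (hX x y hxy).mp hxX
    exact Relation.ReflTransGen.tail hx ⟨hxX, hyX, fun i => by rw [hxy]; simp⟩
  · intro hy
    have hyX : y ∈ X := PConn.mem_right ha hy
    have hxX : x ∈ X := (hX x y hxy).mpr hyX
    exact Relation.ReflTransGen.tail hy ⟨hyX, hxX, fun i => by rw [hxy]; simp⟩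

/-- **Separation at site level.**  A touching-component distinct from that of `a` lies outside the one-cube
enlargement `(pComp s X a)^{∼1}` (`enl s 1`, [I] p. 257's `X̃`). [cite: Balaban1988Convergent, (2.19) p.258] -/
theorem pComp_subset_compl_enl {s : ℕ} {X : Set (Pt d)} {a b : Pt d} (ha : a ∈ X) (hb : b ∈ X)
    (hab : ¬ PConn s X a b) : pComp s X b ⊆ (enl s 1 (pComp s X a))ᶜ := by
  intro y hy hyenl
  obtain ⟨x, hx, hnear⟩ := hyenl
  apply hab
  have hxX : x ∈ X := PConn.mem_right ha hx
  have hyX : y ∈ X := PConn.mem_right hb hy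
  exact (Relation.ReflTransGen.tail hx ⟨hxX, hyX, hnear.symm⟩).trans (PConn.symm hy)

/-- Hence sites of distinct touching-components are at sup-distance `> s` (NOT `Within s`): the components are
separated by at least one full cube width — the form in which cell GAPS.md C-adv5-15 uses the convention for the
sentence after (2.21) (there: «dist(K, K′) ≥ LMR_{j+1}» for two components K, K′ of `Z_{j+1}∩Ω_{j+1}`; the
identification of `s` with the printed cube size is that row's, not typed here). [cite: Balaban1988Convergent, p.258 (after (2.21))] -/
theorem not_within_of_not_pconn {s : ℕ} (hs : 0 < s) {X : Set (Pt d)} {a b : Pt d} (ha : a ∈ X) (hb : b ∈ X)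
    (hab : ¬ PConn s X a b) {x y : Pt d} (hx : x ∈ pComp s X a) (hy : y ∈ pComp s X b) :
    ¬ Within (s : ℤ) x y := by
  have h := not_within_of_subset_compl_enl s 1 hs (pComp_subset_compl_enl ha hb hab) hy hx
  simp only [Nat.cast_one, one_mul] at h
  intro hw
  exact h (fun i => by rw [abs_sub_comm]; exact hw i)

/-! ## E. Bonds never cross a corner ([I] p. 251: bonds connect nearest neighbour sites) -/

/-- Integer division by `s ≥ 1` moves by at most one when the numerator moves by one. [folklore] -/
theorem ediv_succ_cases (a : ℤ) {s : ℕ} (hs : 0 < s) : (a + 1) / (s : ℤ) = a / s ∨ (a + 1) / (s : ℤ) = a / s + 1 := by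
  have hs' : (0 : ℤ) < s := by exact_mod_cast hs
  have h1 : a / (s : ℤ) ≤ (a + 1) / s := Int.ediv_le_ediv hs' (by linarith)
  have h2 : (a + 1) / (s : ℤ) ≤ (a + s) / s := Int.ediv_le_ediv hs' (by linarith)
  have h3 : (a + s) / (s : ℤ) = a / s + 1 := by
    rw [show a + (s : ℤ) = a + 1 * s by ring, Int.add_mul_ediv_right _ _ hs'.ne']
  omega

/-- The cubes of the two endpoints `x`, `x + e_μ` of a lattice bond are EQUAL or WALL-ADJACENT (`s ≥ 1`): a bond
never joins two cubes that touch only along a face of dimension `< d−1`.  With [I] p. 251's convention (a region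
owns the bonds which intersect it) corner-touching cubes therefore share no bond. [cite: Balaban1987RG1, p.251] -/
theorem bond_cubes {s : ℕ} (hs : 0 < s) (x : Pt d) (μ : Fin d) :
    cubeIdx s (x + Pi.single μ 1) = cubeIdx s x ∨ WallAdjacent (cubeIdx s x) (cubeIdx s (x + Pi.single μ 1)) := by
  have hoff : ∀ j, j ≠ μ → cubeIdx s (x + Pi.single μ 1) j = cubeIdx s x j := by
    intro j hj
    simp [cubeIdx, hj]
  have hμ : cubeIdx s (x + Pi.single μ 1) μ = (x μ + 1) / (s : ℤ) := by
    simp [cubeIdx]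
  rcases ediv_succ_cases (x μ) hs with h | h
  · left
    funext j
    by_cases hj : j = μ
    · subst hj; rw [hμ, h]; rfl
    · exact hoff j hj
  · right
    refine ⟨μ, ?_, fun j hj => (hoff j hj).symm⟩
    rw [hμ, h]
    simp [cubeIdx]

end Literature.MathematicalPhysics.QuantumFieldTheory.Balaban1983to89.B14Components
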